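import Mathlib.Tactic.Ring
import Mathlib.Tactic.Linarith
import Literature.Computability.Complexity.NegationElimination
import HarnessLib

/-!
# Monotone block programs: compiling bitwise recursions into monotone straight-line programs

Infrastructure for feasible-interpolation theorems (`CuttingPlanesInterpolation.lean`): a uniform
way to turn a RECURSION ON BITS — bit number `s` is a monotone formula (`MForm`: inputs, earlier
bits, `0`, `1`, `∧`, `∨`) of the input variables and of the bits `s' < s` — into a straight-line
program over `{∧₂, ∨₂, 0, 1}` (`GateList` calculus of `CircuitComposition.lean` /
`NegationElimination.lean`) and finally into a circuit over the tree's monotone basis `{∧₂, ∨₂}`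
(`Circuit.lean`), with an explicit size bound.

* `MForm X`, `MForm.eval`, `MForm.size`, `MForm.disj` (big disjunction);
* the SEMANTIC bits `BlockProg.bit spec a s` of a specification `spec : ℕ → MForm X`
  (bit `s` evaluates `spec s` with the earlier bits as environment, later bits read `false`),
  `BlockProg.bit_eq`, monotonicity in the input (`BlockProg.bit_mono`);
* the COMPILED program `BlockProg.prog spec P n`: bit slot `s < n` occupies the `P` gates
  `[s P, (s+1) P)` (the postorder compilation of `spec s`, padding, and a final copy gate), its
  value sits on the wire `BlockProg.outWire P s = s P + (P - 1)`; requires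
  `size (spec s) + 1 ≤ P`;
* `BlockProg.prog_value` — the wire of slot `s` carries `bit spec a s`;
* `BlockProg.const_or_exists_circuit` — hence each bit is constant or computed by a circuit over
  `{∧₂, ∨₂}` with at most `n P` gates (constant elimination,
  `GateList.const_or_exists_monotone_circuit`).

## References

* S. Arora, B. Barak, *Computational Complexity* (2009), Rem. 6.4 (straight-line programs)
  [AroraBarakCC2009].
* P. Pudlák, J. Symbolic Logic 62 (1997), §3 (interpolants as circuits built along a proof)
  [Pudlak1997].
-/

namespace Literature.Computability.Complexity

open GateList

/-- MONOTONE FORMULAS over input variables `X` and numbered bits: inputs, bit references, the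
constants and binary `∧`, `∨`. [folklore] -/
inductive MForm (X : Type*) : Type _
  /-- an input variable -/
  | input (x : X) : MForm X
  /-- a reference to bit number `s` -/
  | bit (s : ℕ) : MForm X
  /-- the constant `true` -/
  | tt : MForm X
  /-- the constant `false` -/
  | ff : MForm X
  /-- conjunction -/
  | and (f g : MForm X) : MForm X
  /-- disjunction -/
  | or (f g : MForm X) : MForm X

namespace MForm

variable {X : Type*}

/-- The number of nodes of a formula (= the number of gates it compiles to). [folklore] -/
def size : MForm X → ℕ
  | input _ => 1
  | bit _ => 1
  | tt => 1
  | ff => 1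
  | and f g => f.size + g.size + 1
  | or f g => f.size + g.size + 1

/-- Every formula has a node. [folklore] -/
theorem one_le_size (f : MForm X) : 1 ≤ f.size := by
  cases f <;> simp [size]

/-- Evaluation of a formula on an input `a` and a bit environment `env`. [folklore] -/
def eval (a : X → Bool) (env : ℕ → Bool) : MForm X → Bool
  | input x => a x
  | bit s => env s
  | tt => true
  | ff => false
  | and f g => f.eval a env && g.eval a env
  | or f g => f.eval a env || g.eval a env

/-- `eval` of the constructors (for `simp`). [folklore] -/
@[simp] theorem eval_input (a : X → Bool) (env : ℕ → Bool) (x : X) : (input x).eval a env = a x := rfl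

/-- `eval` of a bit reference. [folklore] -/
@[simp] theorem eval_bit (a : X → Bool) (env : ℕ → Bool) (s : ℕ) : (bit s : MForm X).eval a env = env s := rfl

/-- `eval` of `tt`. [folklore] -/
@[simp] theorem eval_tt (a : X → Bool) (env : ℕ → Bool) : (tt : MForm X).eval a env = true := rfl

/-- `eval` of `ff`. [folklore] -/
@[simp] theorem eval_ff (a : X → Bool) (env : ℕ → Bool) : (ff : MForm X).eval a env = false := rfl

/-- `eval` of a conjunction. [folklore] -/
@[simp] theorem eval_and (a : X → Bool) (env : ℕ → Bool) (f g : MForm X) :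
    (and f g).eval a env = (f.eval a env && g.eval a env) := rfl

/-- `eval` of a disjunction. [folklore] -/
@[simp] theorem eval_or (a : X → Bool) (env : ℕ → Bool) (f g : MForm X) :
    (or f g).eval a env = (f.eval a env || g.eval a env) := rfl

/-- Evaluation is monotone in the input and in the environment. [folklore] -/
theorem eval_mono {a a' : X → Bool} {env env' : ℕ → Bool} (ha : a ≤ a') (he : env ≤ env') :
    ∀ f : MForm X, f.eval a env ≤ f.eval a' env'
  | input x => ha x
  | bit s => he s
  | tt => le_rfl
  | ff => le_rfl
  | and f g => by
    have hf := eval_mono ha he f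
    have hg := eval_mono ha he g
    simp only [eval]
    revert hf hg
    cases f.eval a env <;> cases g.eval a env <;> cases f.eval a' env' <;> cases g.eval a' env' <;> simp
  | or f g => by
    have hf := eval_mono ha he f
    have hg := eval_mono ha he g
    simp only [eval]
    revert hf hg
    cases f.eval a env <;> cases g.eval a env <;> cases f.eval a' env' <;> cases g.eval a' env' <;> simp

/-- The Boolean cast of a decidable proposition as a constant formula. [folklore] -/
def ofBool (b : Bool) : MForm X := if b then tt else ff

/-- `ofBool` evaluates to the Boolean. [folklore] -/
@[simp] theorem eval_ofBool (a : X → Bool) (env : ℕ → Bool) (b : Bool) : (ofBool b : MForm X).eval a env = b := by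
  cases b <;> rfl

/-- `ofBool` has size `1`. [folklore] -/
@[simp] theorem size_ofBool (b : Bool) : (ofBool b : MForm X).size = 1 := by
  cases b <;> rfl

/-- Big disjunction of a list of formulas. [folklore] -/
def disj : List (MForm X) → MForm X
  | [] => ff
  | f :: l => or f (disj l)

/-- A big disjunction is true iff some disjunct is. [folklore] -/
theorem eval_disj (a : X → Bool) (env : ℕ → Bool) :
    ∀ l : List (MForm X), (disj l).eval a env = l.any fun f => f.eval a env
  | [] => rfl
  | f :: l => by rw [disj, eval_or, eval_disj a env l, List.any_cons]

/-- Size of a big disjunction. [folklore] -/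
theorem size_disj : ∀ l : List (MForm X), (disj l).size = (l.map size).sum + l.length + 1
  | [] => rfl
  | f :: l => by
    rw [disj, size, size_disj l]
    simp only [List.map_cons, List.sum_cons, List.length_cons]
    ring

/-- Size of a big disjunction with uniformly bounded disjuncts. [folklore] -/
theorem size_disj_le {l : List (MForm X)} {c : ℕ} (h : ∀ f ∈ l, f.size ≤ c) :
    (disj l).size ≤ l.length * (c + 1) + 1 := by
  rw [size_disj]
  have : (l.map size).sum ≤ l.length * c := by
    induction l with
    | nil => simp
    | cons f l ih =>
      simp only [List.map_cons, List.sum_cons, List.length_cons]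
      have hf := h f (by simp)
      have := ih fun g hg => h g (by simp [hg])
      rw [Nat.succ_mul]
      omega
  have h2 : l.length * (c + 1) = l.length * c + l.length := by ring
  omega

end MForm

namespace BlockProg

variable {X : Type*}

/-! ### Semantic bits -/

section Semantics

variable (spec : ℕ → MForm X)

/-- The values of the bits `0, …, s-1` of the specification `spec` on input `a`, computed in
order (bit `s` reads the earlier bits; references to later bits read `false`). [folklore] -/
def bvals (a : X → Bool) : ℕ → List Bool
  | 0 => []
  | s + 1 => bvals a s ++ [(spec s).eval a fun s' => (bvals a s).getD s' false]

/-- The SEMANTIC BIT `s` of the specification on input `a`. [folklore] -/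
def bit (a : X → Bool) (s : ℕ) : Bool :=
  (spec s).eval a fun s' => (bvals spec a s).getD s' false

/-- `bvals` lists `s` bits. [folklore] -/
@[simp] theorem length_bvals (a : X → Bool) : ∀ s, (bvals spec a s).length = s
  | 0 => rfl
  | s + 1 => by rw [bvals, List.length_append, length_bvals a s]; rfl

/-- The listed bits are the semantic bits. [folklore] -/
theorem getD_bvals (a : X → Bool) : ∀ {s s' : ℕ}, s' < s → (bvals spec a s).getD s' false = bit spec a s'
  | 0, _, h => absurd h (Nat.not_lt_zero _)
  | s + 1, s', h => by
    rw [bvals, List.getD_eq_getElem?_getD]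
    rcases Nat.lt_succ_iff_lt_or_eq.1 h with h' | rfl
    · rw [List.getElem?_append_left (by simpa using h'), ← List.getD_eq_getElem?_getD]
      exact getD_bvals a h'
    · rw [List.getElem?_append_right (by simp), length_bvals, Nat.sub_self]
      rfl

/-- Out-of-range entries read `false`. [folklore] -/
theorem getD_bvals_of_le (a : X → Bool) {s s' : ℕ} (h : s ≤ s') : (bvals spec a s).getD s' false = false := by
  rw [List.getD_eq_getElem?_getD, List.getElem?_eq_none (by simpa using h)]
  rfl

/-- **The bit recursion**: bit `s` is its formula evaluated on the earlier bits.
[folklore] -/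
theorem bit_eq (a : X → Bool) (s : ℕ) :
    bit spec a s = (spec s).eval a fun s' => if s' < s then bit spec a s' else false := by
  unfold bit
  congr 1
  funext s'
  split_ifs with h
  · exact getD_bvals spec a h
  · exact getD_bvals_of_le spec a (not_lt.1 h)

/-- The bits are monotone functions of the input. [folklore] -/
theorem bit_mono (s : ℕ) : Monotone fun a => bit spec a s := by
  induction s using Nat.strong_induction_on with
  | _ s ih =>
    intro a a' haa'
    simp only
    rw [bit_eq spec a s, bit_eq spec a' s]
    refine MForm.eval_mono haa' (fun s' => ?_) _
    simp only
    split_ifs with h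
    · exact ih s' h haa'
    · exact le_rfl

end Semantics

/-! ### Compilation -/

section Compile

variable (P : ℕ)

/-- The wire carrying bit `s'`: the last gate of its slot. [folklore] -/
def outWire (s' : ℕ) : X ⊕ ℕ := Sum.inr (s' * P + (P - 1))

/-- Postorder compilation of a formula of bit slot `s`, to be placed at gate index `base`: one
gate per node, the root last; references to bits `s' ≥ s` compile to the constant `false`.
[folklore] -/
def compile (s : ℕ) : MForm X → ℕ → List (Gate X)
  | .input x, _ => [andGate (Sum.inl x) (Sum.inl x)]
  | .bit s', _ => if s' < s then [andGate (outWire P s') (outWire P s')] else [constGate X false]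
  | .tt, _ => [constGate X true]
  | .ff, _ => [constGate X false]
  | .and f g, base => compile s f base ++ compile s g (base + f.size) ++
      [andGate (Sum.inr (base + f.size - 1)) (Sum.inr (base + f.size + g.size - 1))]
  | .or f g, base => compile s f base ++ compile s g (base + f.size) ++
      [orGate (Sum.inr (base + f.size - 1)) (Sum.inr (base + f.size + g.size - 1))]

/-- Compilation emits one gate per node. [folklore] -/
@[simp] theorem length_compile (s : ℕ) : ∀ (f : MForm X) (base : ℕ), (compile P s f base).length = f.size
  | .input x, _ => rfl
  | .bit s', _ => by unfold compile; split_ifs <;> rfl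
  | .tt, _ => rfl
  | .ff, _ => rfl
  | .and f g, base => by
    show (compile P s f base ++ compile P s g (base + f.size) ++ [_]).length = f.size + g.size + 1
    simp only [List.length_append, List.length_singleton, length_compile s f, length_compile s g]
  | .or f g, base => by
    show (compile P s f base ++ compile P s g (base + f.size) ++ [_]).length = f.size + g.size + 1
    simp only [List.length_append, List.length_singleton, length_compile s f, length_compile s g]

/-- All compiled gates are `∧₂`, `∨₂` or constants. [folklore] -/
theorem compile_mem_monotoneBasis01 (s : ℕ) :
    ∀ (f : MForm X) (base : ℕ), ∀ g ∈ compile P s f base, g.fn ∈ monotoneBasis01 := by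
  have hc : ∀ b, (constGate X b).fn ∈ monotoneBasis01 := fun b => by
    rw [constGate_fn]
    cases b
    · exact Set.mem_insert_of_mem _ (Set.mem_insert _ _)
    · exact Set.mem_insert _ _
  have ha : ∀ u v : X ⊕ ℕ, (andGate u v).fn ∈ monotoneBasis01 := fun u v =>
    monotoneBasis_subset_monotoneBasis01 (by rw [andGate_fn]; exact and_mem_monotoneBasis)
  have ho : ∀ u v : X ⊕ ℕ, (orGate u v).fn ∈ monotoneBasis01 := fun u v =>
    monotoneBasis_subset_monotoneBasis01 (by rw [orGate_fn]; exact or_mem_monotoneBasis)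
  intro f
  induction f with
  | input x => intro base g hg; simp [compile] at hg; subst hg; exact ha _ _
  | bit s' =>
    intro base g hg
    unfold compile at hg
    split_ifs at hg <;> simp at hg <;> subst hg
    · exact ha _ _
    · exact hc _
  | tt => intro base g hg; simp [compile] at hg; subst hg; exact hc _
  | ff => intro base g hg; simp [compile] at hg; subst hg; exact hc _
  | and f g ihf ihg =>
    intro base g' hg
    simp only [compile, List.mem_append, List.mem_singleton] at hg
    rcases hg with (hg | hg) | rfl
    · exact ihf _ _ hg
    · exact ihg _ _ hg
    · exact ha _ _
  | or f g ihf ihg =>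
    intro base g' hg
    simp only [compile, List.mem_append, List.mem_singleton] at hg
    rcases hg with (hg | hg) | rfl
    · exact ihf _ _ hg
    · exact ihg _ _ hg
    · exact ho _ _

/-- Compiled gates only read earlier positions (given `1 ≤ P` and `s P ≤ base`). [folklore] -/
theorem compile_gateOK (hP : 1 ≤ P) (s : ℕ) :
    ∀ (f : MForm X) (base : ℕ), s * P ≤ base →
      ∀ (j : ℕ) (g : Gate X), (compile P s f base)[j]? = some g → GateOK (base + j) g := by
  intro f
  induction f with
  | input x =>
    intro base _ j g hg
    obtain ⟨rfl, rfl⟩ : j = 0 ∧ andGate (Sum.inl x) (Sum.inl x) = g := by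
      simpa [compile, List.getElem?_singleton] using hg
    exact gateOK_andGate (fun m hm => by cases hm) (fun m hm => by cases hm)
  | bit s' =>
    intro base hbase j g hg
    unfold compile at hg
    split_ifs at hg with h
    · obtain ⟨rfl, rfl⟩ : j = 0 ∧ andGate (outWire P s') (outWire P s') = g := by
        simpa [List.getElem?_singleton] using hg
      have hlt : s' * P + (P - 1) < base := by
        have h1 : s' * P + P ≤ s * P := by
          have := Nat.mul_le_mul_right P h
          rwa [Nat.succ_mul] at this
        omega
      refine gateOK_andGate (fun m hm => ?_) (fun m hm => ?_) <;>
        · simp only [outWire, Sum.inr.injEq] at hm; omega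
    · obtain ⟨rfl, rfl⟩ : j = 0 ∧ constGate X false = g := by
        simpa [List.getElem?_singleton] using hg
      exact gateOK_constGate _ _
  | tt =>
    intro base _ j g hg
    obtain ⟨rfl, rfl⟩ : j = 0 ∧ constGate X true = g := by simpa [compile, List.getElem?_singleton] using hg
    exact gateOK_constGate _ _
  | ff =>
    intro base _ j g hg
    obtain ⟨rfl, rfl⟩ : j = 0 ∧ constGate X false = g := by simpa [compile, List.getElem?_singleton] using hg
    exact gateOK_constGate _ _
  | and f g ihf ihg =>
    intro base hbase j g' hg
    simp only [compile] at hg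
    have hf1 := f.one_le_size
    have hg1 := g.one_le_size
    by_cases hj : j < f.size
    · rw [List.append_assoc, List.getElem?_append_left (by simpa using hj)] at hg
      exact ihf base hbase j g' hg
    · rw [List.append_assoc, List.getElem?_append_right (by simpa using not_lt.1 hj),
        length_compile] at hg
      by_cases hj' : j - f.size < g.size
      · rw [List.getElem?_append_left (by simpa using hj')] at hg
        have := ihg (base + f.size) (by omega) (j - f.size) g' hg
        rwa [show base + f.size + (j - f.size) = base + j by omega] at this
      · rw [List.getElem?_append_right (by simpa using not_lt.1 hj'), length_compile] at hg
        obtain ⟨hj0, rfl⟩ : j - f.size - g.size = 0 ∧ _ = g' := by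
          simpa [List.getElem?_singleton] using hg
        refine gateOK_andGate (fun m hm => ?_) (fun m hm => ?_) <;>
          · simp only [Sum.inr.injEq] at hm; omega
  | or f g ihf ihg =>
    intro base hbase j g' hg
    simp only [compile] at hg
    have hf1 := f.one_le_size
    have hg1 := g.one_le_size
    by_cases hj : j < f.size
    · rw [List.append_assoc, List.getElem?_append_left (by simpa using hj)] at hg
      exact ihf base hbase j g' hg
    · rw [List.append_assoc, List.getElem?_append_right (by simpa using not_lt.1 hj),
        length_compile] at hg
      by_cases hj' : j - f.size < g.size
      · rw [List.getElem?_append_left (by simpa using hj')] at hg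
        have := ihg (base + f.size) (by omega) (j - f.size) g' hg
        rwa [show base + f.size + (j - f.size) = base + j by omega] at this
      · rw [List.getElem?_append_right (by simpa using not_lt.1 hj'), length_compile] at hg
        obtain ⟨hj0, rfl⟩ : j - f.size - g.size = 0 ∧ _ = g' := by
          simpa [List.getElem?_singleton] using hg
        refine gateOK_orGate (fun m hm => ?_) (fun m hm => ?_) <;>
          · simp only [Sum.inr.injEq] at hm; omega

/-- Gate values of a prefix are unchanged by appending gates. [folklore] -/
theorem getD_vals_append_left (L M : List (Gate X)) (a : X → Bool) {i : ℕ} (hi : i < L.length) :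
    (vals (L ++ M) a).getD i false = (vals L a).getD i false := by
  obtain ⟨ws, h⟩ := vals_append_take L M a
  rw [h, List.getD_eq_getElem?_getD, List.getD_eq_getElem?_getD,
    List.getElem?_append_left (by simpa using hi)]

/-- **Correctness of compilation**: placed at index `base` (after a prefix `pre` of that
length whose slot wires carry the environment `env` on the bits `s' < s`), the root gate of the
compiled formula carries its value. [folklore] -/
theorem compile_value (a : X → Bool) (hP : 1 ≤ P) (s : ℕ) (env : ℕ → Bool) :
    ∀ (f : MForm X) (pre post : List (Gate X)) (base : ℕ), pre.length = base → s * P ≤ base →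
      (∀ s' < s, (vals pre a).getD (s' * P + (P - 1)) false = env s') →
      (vals (pre ++ compile P s f base ++ post) a).getD (base + f.size - 1) false =
        f.eval a fun s' => if s' < s then env s' else false := by
  intro f
  induction f with
  | input x =>
    intro pre post base hpre _ _
    rw [compile, List.append_assoc, List.singleton_append, MForm.size, Nat.add_sub_cancel, ← hpre,
      getD_vals_append_cons, andGate_op]
    simp
  | bit s' =>
    intro pre post base hpre hbase henv
    unfold compile
    split_ifs with h
    · rw [List.append_assoc, List.singleton_append, MForm.size, Nat.add_sub_cancel, ← hpre,
        getD_vals_append_cons, andGate_op, Bool.and_self, outWire, wireOf_inr, henv s' h]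
      simp [h]
    · rw [List.append_assoc, List.singleton_append, MForm.size, Nat.add_sub_cancel, ← hpre,
        getD_vals_append_cons]
      simp [h, constGate]
  | tt =>
    intro pre post base hpre _ _
    rw [compile, List.append_assoc, List.singleton_append, MForm.size, Nat.add_sub_cancel, ← hpre,
      getD_vals_append_cons]
    simp [constGate]
  | ff =>
    intro pre post base hpre _ _
    rw [compile, List.append_assoc, List.singleton_append, MForm.size, Nat.add_sub_cancel, ← hpre,
      getD_vals_append_cons]
    simp [constGate]
  | and f g ihf ihg =>
    intro pre post base hpre hbase henv
    have hf1 := f.one_le_size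
    have hg1 := g.one_le_size
    -- the root of `f`
    have hvf : (vals (pre ++ compile P s (.and f g) base ++ post) a).getD (base + f.size - 1) false =
        f.eval a fun s' => if s' < s then env s' else false := by
      have := ihf pre (compile P s g (base + f.size) ++
        [andGate (Sum.inr (base + f.size - 1)) (Sum.inr (base + f.size + g.size - 1))] ++ post)
        base hpre hbase henv
      simpa [compile, List.append_assoc] using this
    -- the root of `g`
    have hvg : (vals (pre ++ compile P s (.and f g) base ++ post) a).getD (base + f.size + g.size - 1) false =
        g.eval a fun s' => if s' < s then env s' else false := by
      have henv' : ∀ s' < s, (vals (pre ++ compile P s f base) a).getD (s' * P + (P - 1)) false = env s' := by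
        intro s' hs'
        rw [getD_vals_append_left _ _ _ (by
          rw [hpre]
          have h1 : (s' + 1) * P ≤ s * P := Nat.mul_le_mul_right _ hs'
          rw [add_mul, one_mul] at h1
          omega)]
        exact henv s' hs'
      have := ihg (pre ++ compile P s f base)
        ([andGate (Sum.inr (base + f.size - 1)) (Sum.inr (base + f.size + g.size - 1))] ++ post)
        (base + f.size) (by simp [hpre]) (by omega) henv'
      simpa [compile, List.append_assoc] using this
    -- the new gate
    have hsplit : pre ++ compile P s (.and f g) base ++ post =
        (pre ++ compile P s f base ++ compile P s g (base + f.size)) ++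
          (andGate (Sum.inr (base + f.size - 1)) (Sum.inr (base + f.size + g.size - 1)) :: post) := by
      simp [compile, List.append_assoc]
    have hlen : (pre ++ compile P s f base ++ compile P s g (base + f.size)).length = base + f.size + g.size := by
      simp [hpre]; ring
    rw [show base + (MForm.and f g).size - 1 = base + f.size + g.size by rw [MForm.size]; omega]
    rw [hsplit] at hvf hvg ⊢
    have hG := getD_vals_append_cons (pre ++ compile P s f base ++ compile P s g (base + f.size))
      (andGate (Sum.inr (base + f.size - 1)) (Sum.inr (base + f.size + g.size - 1))) post a
    rw [hlen] at hG
    have e1 := getD_vals_append_left (pre ++ compile P s f base ++ compile P s g (base + f.size))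
      (andGate (Sum.inr (base + f.size - 1)) (Sum.inr (base + f.size + g.size - 1)) :: post) a
      (i := base + f.size - 1) (by rw [hlen]; omega)
    have e2 := getD_vals_append_left (pre ++ compile P s f base ++ compile P s g (base + f.size))
      (andGate (Sum.inr (base + f.size - 1)) (Sum.inr (base + f.size + g.size - 1)) :: post) a
      (i := base + f.size + g.size - 1) (by rw [hlen]; omega)
    rw [hG, andGate_op, wireOf_inr, wireOf_inr, MForm.eval_and, ← e1, ← e2, hvf, hvg]
  | or f g ihf ihg =>
    intro pre post base hpre hbase henv
    have hf1 := f.one_le_size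
    have hg1 := g.one_le_size
    have hvf : (vals (pre ++ compile P s (.or f g) base ++ post) a).getD (base + f.size - 1) false =
        f.eval a fun s' => if s' < s then env s' else false := by
      have := ihf pre (compile P s g (base + f.size) ++
        [orGate (Sum.inr (base + f.size - 1)) (Sum.inr (base + f.size + g.size - 1))] ++ post)
        base hpre hbase henv
      simpa [compile, List.append_assoc] using this
    have hvg : (vals (pre ++ compile P s (.or f g) base ++ post) a).getD (base + f.size + g.size - 1) false =
        g.eval a fun s' => if s' < s then env s' else false := by
      have henv' : ∀ s' < s, (vals (pre ++ compile P s f base) a).getD (s' * P + (P - 1)) false = env s' := by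
        intro s' hs'
        rw [getD_vals_append_left _ _ _ (by
          rw [hpre]
          have h1 : (s' + 1) * P ≤ s * P := Nat.mul_le_mul_right _ hs'
          rw [add_mul, one_mul] at h1
          omega)]
        exact henv s' hs'
      have := ihg (pre ++ compile P s f base)
        ([orGate (Sum.inr (base + f.size - 1)) (Sum.inr (base + f.size + g.size - 1))] ++ post)
        (base + f.size) (by simp [hpre]) (by omega) henv'
      simpa [compile, List.append_assoc] using this
    have hsplit : pre ++ compile P s (.or f g) base ++ post =
        (pre ++ compile P s f base ++ compile P s g (base + f.size)) ++
          (orGate (Sum.inr (base + f.size - 1)) (Sum.inr (base + f.size + g.size - 1)) :: post) := by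
      simp [compile, List.append_assoc]
    have hlen : (pre ++ compile P s f base ++ compile P s g (base + f.size)).length = base + f.size + g.size := by
      simp [hpre]; ring
    rw [show base + (MForm.or f g).size - 1 = base + f.size + g.size by rw [MForm.size]; omega]
    rw [hsplit] at hvf hvg ⊢
    have hG := getD_vals_append_cons (pre ++ compile P s f base ++ compile P s g (base + f.size))
      (orGate (Sum.inr (base + f.size - 1)) (Sum.inr (base + f.size + g.size - 1))) post a
    rw [hlen] at hG
    have e1 := getD_vals_append_left (pre ++ compile P s f base ++ compile P s g (base + f.size))
      (orGate (Sum.inr (base + f.size - 1)) (Sum.inr (base + f.size + g.size - 1)) :: post) a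
      (i := base + f.size - 1) (by rw [hlen]; omega)
    have e2 := getD_vals_append_left (pre ++ compile P s f base ++ compile P s g (base + f.size))
      (orGate (Sum.inr (base + f.size - 1)) (Sum.inr (base + f.size + g.size - 1)) :: post) a
      (i := base + f.size + g.size - 1) (by rw [hlen]; omega)
    rw [hG, orGate_op, wireOf_inr, wireOf_inr, MForm.eval_or, ← e1, ← e2, hvf, hvg]

variable (spec : ℕ → MForm X)

/-- The gates of bit slot `s`: the compiled formula at `s P`, padding, and a final copy gate
putting the value on `outWire P s` (total length `P` when `size (spec s) + 1 ≤ P`). [folklore] -/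
def slotGates (s : ℕ) : List (Gate X) :=
  compile P s (spec s) (s * P) ++ List.replicate (P - 1 - (spec s).size) (constGate X false) ++
    [andGate (Sum.inr (s * P + ((spec s).size - 1))) (Sum.inr (s * P + ((spec s).size - 1)))]

/-- A slot has `P` gates. [folklore] -/
theorem length_slotGates {s : ℕ} (h : (spec s).size + 1 ≤ P) : (slotGates P spec s).length = P := by
  simp [slotGates]
  omega

/-- The program of the first `n` slots. [folklore] -/
def prog (n : ℕ) : List (Gate X) := (List.range n).flatMap (slotGates P spec)

/-- One more slot. [folklore] -/
theorem prog_succ (n : ℕ) : prog P spec (n + 1) = prog P spec n ++ slotGates P spec n := by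
  simp [prog, List.range_succ, List.flatMap_append]

/-- Length of the program. [folklore] -/
theorem length_prog {n : ℕ} (h : ∀ s < n, (spec s).size + 1 ≤ P) : (prog P spec n).length = n * P := by
  induction n with
  | zero => simp [prog]
  | succ n ih =>
    rw [prog_succ, List.length_append, ih fun s hs => h s (Nat.lt_succ_of_lt hs),
      length_slotGates P spec (h n (Nat.lt_succ_self n))]
    ring

/-- Splitting the program at slot `s < n`. [folklore] -/
theorem prog_split {s n : ℕ} (hs : s < n) : ∃ R, prog P spec n = prog P spec s ++ slotGates P spec s ++ R := by
  induction n with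
  | zero => exact absurd hs (Nat.not_lt_zero _)
  | succ n ih =>
    rcases Nat.lt_succ_iff_lt_or_eq.1 hs with h | rfl
    · obtain ⟨R, hR⟩ := ih h
      exact ⟨R ++ slotGates P spec n, by rw [prog_succ, hR, List.append_assoc]⟩
    · exact ⟨[], by rw [prog_succ, List.append_nil]⟩

/-- Every gate of the program is in `{∧₂, ∨₂, 0, 1}`. [folklore] -/
theorem prog_mem_monotoneBasis01 (n : ℕ) : ∀ g ∈ prog P spec n, g.fn ∈ monotoneBasis01 := by
  intro g hg
  simp only [prog, List.mem_flatMap, List.mem_range] at hg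
  obtain ⟨s, -, hg⟩ := hg
  simp only [slotGates, List.mem_append, List.mem_replicate, List.mem_singleton] at hg
  rcases hg with (hg | ⟨-, rfl⟩) | rfl
  · exact compile_mem_monotoneBasis01 P s _ _ g hg
  · rw [constGate_fn]; exact Set.mem_insert_of_mem _ (Set.mem_insert _ _)
  · exact monotoneBasis_subset_monotoneBasis01 (by rw [andGate_fn]; exact and_mem_monotoneBasis)

/-- The program is well formed. [folklore] -/
theorem wf_prog (hP : 1 ≤ P) {n : ℕ} (h : ∀ s < n, (spec s).size + 1 ≤ P) : WF (prog P spec n) := by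
  induction n with
  | zero => exact WF.nil
  | succ n ih =>
    have h' : ∀ s < n, (spec s).size + 1 ≤ P := fun s hs => h s (Nat.lt_succ_of_lt hs)
    have hn := h n (Nat.lt_succ_self n)
    have hlen := length_prog P spec h'
    have h1 := (spec n).one_le_size
    rw [prog_succ, slotGates, ← List.append_assoc, ← List.append_assoc]
    refine ((WF.append (ih h') fun j g hg => ?_).append fun j g hg => ?_).append_singleton ?_
    · rw [hlen]
      exact compile_gateOK P hP n (spec n) (n * P) le_rfl j g hg
    · obtain ⟨-, rfl⟩ := List.mem_replicate.1 (List.mem_of_getElem? hg)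
      exact gateOK_constGate _ _
    · refine gateOK_andGate (fun m hm => ?_) (fun m hm => ?_) <;>
        · simp only [Sum.inr.injEq] at hm
          simp only [List.length_append, hlen, length_compile, List.length_replicate]
          omega

/-- **The slot wires carry the semantic bits**: for `s < n`, the wire `outWire P s` of the
program carries `bit spec a s`. [folklore] -/
theorem prog_value (a : X → Bool) (hP : 1 ≤ P) {n : ℕ} (h : ∀ s < n, (spec s).size + 1 ≤ P)
    {s : ℕ} (hs : s < n) : (vals (prog P spec n) a).getD (s * P + (P - 1)) false = bit spec a s := by
  induction s using Nat.strong_induction_on with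
  | _ s ih =>
    obtain ⟨R, hR⟩ := prog_split P spec hs
    have hlen : (prog P spec s).length = s * P := length_prog P spec fun s' hs' => h s' (hs'.trans hs)
    have hsz := h s hs
    have h1 := (spec s).one_le_size
    -- the final copy gate of slot `s`
    set pre := prog P spec s ++ (compile P s (spec s) (s * P) ++
      List.replicate (P - 1 - (spec s).size) (constGate X false)) with hpre
    have hplen : pre.length = s * P + (P - 1) := by
      simp [hpre, hlen]; omega
    have hsplit : prog P spec n = pre ++
        (andGate (Sum.inr (s * P + ((spec s).size - 1))) (Sum.inr (s * P + ((spec s).size - 1))) :: R) := by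
      rw [hR, hpre, slotGates]; simp [List.append_assoc]
    rw [hsplit, ← hplen, getD_vals_append_cons, andGate_op, Bool.and_self, wireOf_inr]
    -- the root of the compiled formula, read inside `pre`
    have henv : ∀ s' < s, (vals (prog P spec s) a).getD (s' * P + (P - 1)) false = bit spec a s' := by
      intro s' hs'
      have := ih s' hs' (hs'.trans hs)
      rwa [hR, List.append_assoc, getD_vals_append_left _ _ _ (by
        rw [hlen]
        have h2 : (s' + 1) * P ≤ s * P := Nat.mul_le_mul_right _ hs'
        rw [add_mul, one_mul] at h2
        omega)] at this
    have hv := compile_value P a hP s (bit spec a) (spec s) (prog P spec s)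
      (List.replicate (P - 1 - (spec s).size) (constGate X false)) (s * P) hlen le_rfl henv
    rw [show s * P + (spec s).size - 1 = s * P + ((spec s).size - 1) by omega] at hv
    rw [hpre, ← List.append_assoc, hv, bit_eq]

/-- **Each bit is constant or computed by a monotone circuit of size `≤ n P`.** [folklore] -/
theorem const_or_exists_circuit (hP : 1 ≤ P) {n : ℕ} (h : ∀ s < n, (spec s).size + 1 ≤ P)
    {s₀ : ℕ} (hs₀ : s₀ < n) :
    (∃ b, ∀ a, bit spec a s₀ = b) ∨
      ∃ C : Circuit X, C.IsOver monotoneBasis ∧ C.size ≤ n * P ∧ ∀ a, C.eval a = bit spec a s₀ := by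
  have hlen := length_prog P spec h
  have hout : OutOK (prog P spec n).length (outWire P s₀ : X ⊕ ℕ) := by
    intro m hm
    simp only [outWire, Sum.inr.injEq] at hm
    rw [hlen]
    have h2 : (s₀ + 1) * P ≤ n * P := Nat.mul_le_mul_right _ hs₀
    rw [add_mul, one_mul] at h2
    omega
  rcases const_or_exists_monotone_circuit (prog P spec n) (outWire P s₀) (wf_prog P spec hP h)
      (prog_mem_monotoneBasis01 P spec n) hout with ⟨b, hb⟩ | ⟨C, hC, hs, hCe⟩
  · refine Or.inl ⟨b, fun a => ?_⟩
    rw [← hb a, outWire, wireOf_inr, prog_value P spec a hP h hs₀]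
  · refine Or.inr ⟨C, hC, hlen ▸ hs, fun a => ?_⟩
    rw [hCe a, outWire, wireOf_inr, prog_value P spec a hP h hs₀]

end Compile

end BlockProg

end Literature.Computability.Complexity
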